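import Literature.NumberTheory.Automorphic.ShimuraCurveRibetTakahashi
import Literature.NumberTheory.EllipticCurves.IsogenyDegreeLatticeIndexProofs
import Literature.NumberTheory.EllipticCurves.ComplexMultiplicationLFunctionIsogenyHoldsProofs
import Literature.NumberTheory.EllipticCurves.IsogenyDualProofs
import Literature.NumberTheory.EllipticCurves.IsogenyCompProofs
import Literature.NumberTheory.EllipticCurves.RationalIsogenyDegrees
import Literature.NumberTheory.EllipticCurves.ModularCurveNeronLatticeProofs
import Literature.NumberTheory.EllipticCurves.ModularParametrizationProofs
import HarnessLib

/-!
# `minimalDegree_le_163_mul`: the composite of a Shimura-curve parametrisation with an isogeny,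
# and the reduction to the theorem of Mazur–Kenku

A proofs-only companion (theorems only: no definition, no named fact, nothing restated; D-0026) of
`ShimuraCurveRibetTakahashi.lean`, written by the seat of its named fact
`Literature.NumberTheory.Automorphic.ShimuraParametrizationData.minimalDegree_le_163_mul`
(Pasten 2024, §16 p. 49: *"Since `A_{1,N}` and `A_{D,M}` are both isogenous to `E`, they are
connected by an isogeny of degree `≤ 163`"*; proof of Lemma 6.8, p. 22: *"by results of Mazur
[MazurRatIsog] and Kenku [Kenku] we know that `n := deg(α) ≤ 163`"*; recorded over the tree as:
if `P` realises `δ_{D,M}(W')` and `P'` has minimal degree among the data of `W'`, then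
`P'.deg ≤ 163 · P.deg`).

The printed argument has two ingredients: (i) Mazur–Kenku, and (ii) "compose the degree-`δ` map
`X₀^D(M) → A` with the isogeny; degrees multiply". Ingredient (ii) is PROVED here in the tree's
analytic currency (`ShimuraParametrizationData`: a datum is a weight-`2` form on `Γ₀^D(M)` with
periods in a Néron lattice `Λ`, the uniformisation `ℂ → W(ℂ)` of `Λ`, and a fibre count);
ingredient (i) is the tree's named fact
`Literature.NumberTheory.EllipticCurves.mazurKenku_exists_cyclic_isogeny` (Mazur 1978, Thm. 1;
Kenku 1982; Silverman AEC IX.6 Ex. 6.4), not proved in the tree, and is the ONLY hypothesis of the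
final reduction. What is proved (sorry-free):

* `segmentIntegral_const_mul`, `segmentIntegral_smul` — `∫_z^w c s = c ∫_z^w s`.
* `exists_ball_subset_upperHalfPlane`, `exists_segmentIntegral_eq_sub`,
  `segmentIntegral_add_segmentIntegral` — **Cauchy's theorem for triangles in `ℍ`**: for `s`
  holomorphic on `ℍ`, `∫_z^w s + ∫_w^v s = ∫_z^v s` (the three vertices lie in a disc inside `ℍ`;
  on a disc a holomorphic function has a primitive — Mathlib's `DifferentiableOn.isExactOn_ball` —
  and the segment integral is a difference of its values, by the fundamental theorem of calculus).
* `ShimuraParametrizationData.φ_smul`, `φ_eq_of_orbitRel` — hence **`φ(γτ) = φ(τ)`**: the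
  parametrisation `φ = u ∘ ∫ form` of a datum descends to `Γ₀^D(M)\ℍ` (a private copy of the
  period computation `∫_{τ₀}^{γτ} form − ∫_{τ₀}^{τ} form ∈ Λ`, which the tree also has as
  `segmentIntegral_smul_sub_mem` in `ShimuraCurveDegreeFormulaProofs.lean`).
* `ShimuraCurveData.heckeFun_const_smul` — `T_n(c h) = c T_n h` (`det = n > 0`, so Mathlib's
  `σ` is the identity on `ι(O(n))`).
* `ShimuraParametrizationData.exists_deg_eq_natCard_ker_mul` — **the composite datum**: from a
  datum `P` of `W`, an elliptic `W'` with `L(W', s) = L(W, s)`, a Néron lattice `Λ'` of `W'` and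
  `α ≠ 0` with `αΛ ⊆ Λ'`, a datum of `W'` on the same `X₀^D(M)` of degree
  `#ker(z ↦ αz : ℂ/Λ → ℂ/Λ') · P.deg` (form `α · form`; uniformisation of `Λ'` by the tree's
  theorem `IsNeronLatticeOf.exists_uniformize_holds`, AEC VI.3.6(b); fibre count by the tree's
  `finite_setOf_natCard_fiber_comp_ne` and `natCard_fiber_mulQuotientMap`).
* `ShimuraParametrizationData.deg_le_163_mul_deg_of_isIsogenous` — **the reduction, in its
  natural generality**: granted `mazurKenku_exists_cyclic_isogeny`, for ANY datum `P` of `W` and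
  any datum `P'` of minimal degree among the data of a `ℚ`-isogenous `W'` on the same curve,
  `P'.deg ≤ 163 · P.deg` — via the short models (`shortModel_baseChange_eq_curve`), the rational
  multiplier of a `ℚ`-isogeny with `deg ψ = [Λ' : qΛ]`
  (`degree_eq_natCard_ker_mulQuotientMap_of_baseChange_eq_curve`, AEC VI.4.1(b), III.5), isogeny
  invariance of the `L`-function (`IsIsogenous.LFunction_eq`, Faltings/Knapp 11.67) and the
  composite datum.
* `ShimuraParametrizationData.minimalDegree_le_163_mul_of_mazurKenku` — the same with the
  hypothesis `P.IsMinimalFor W'` of the named fact (whose minimality clause is not used), stated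
  with EXPLICIT binders: its type is, binder for binder, the body of the named fact
  `ShimuraParametrizationData.minimalDegree_le_163_mul`, so that
  (a) `theorem minimalDegree_le_163_mul_holds : minimalDegree_le_163_mul := fun P P' ↦
  minimalDegree_le_163_mul_of_mazurKenku mazurKenku_exists_cyclic_isogeny_holds P P'` is the
  discharge the moment Mazur–Kenku is a theorem of the tree, and (b) a consumer of the fact
  (`h163 P₀ P' hP₀ hP'`) may instead take `hMK : mazurKenku_exists_cyclic_isogeny` and write
  `minimalDegree_le_163_mul_of_mazurKenku hMK P₀ P' hP₀ hP'` — this file no longer mentions the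
  named fact in any statement (review of 2026-08-16: the fact is the Shimura-curve corollary of
  `mazurKenku_exists_cyclic_isogeny` and nothing more, and is slated to be merged into it).

## References

* H. Pasten, *Shimura curves and the abc conjecture*, J. Number Theory 254 (2024) 214–335 =
  arXiv:1705.09251: §16 p. 49, Lemma 6.8 (proof) p. 22, proof of Prop. 5.1 p. 17, §3 p. 13.
  [PastenShimura2024]
* B. Mazur, *Rational isogenies of prime degree*, Invent. Math. 44 (1978) 129–162, Thm. 1.
  [Mazur1978]
* M. A. Kenku, *On the number of `ℚ`-isomorphism classes of elliptic curves in each `ℚ`-isogeny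
  class*, J. Number Theory 15 (1982) 199–202. [Kenku1982]
* J. H. Silverman, *The Arithmetic of Elliptic Curves*, 2nd ed., GTM 106 (2009): IX.6 Ex. 6.4,
  Thm. VI.4.1, Prop. VI.3.6. [SilvermanAEC2009]
-/

noncomputable section

open scoped MatrixGroups ModularForm
open _root_.MeasureTheory UpperHalfPlane

namespace Literature.NumberTheory.Automorphic

/-! ### Segment integrals: linearity and additivity on triangles -/

/-- `∫_z^w c·s = c ∫_z^w s`. [folklore] -/
theorem segmentIntegral_const_mul (c : ℂ) (s : ℍ → ℂ) (z w : ℍ) :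
    segmentIntegral (fun τ => c * s τ) z w = c * segmentIntegral s z w := by
  simp only [segmentIntegral, mul_assoc, intervalIntegral.integral_const_mul]

/-- `∫_z^w (c • s) = c ∫_z^w s`. [folklore] -/
theorem segmentIntegral_smul (c : ℂ) (s : ℍ → ℂ) (z w : ℍ) :
    segmentIntegral (c • s) z w = c * segmentIntegral s z w :=
  segmentIntegral_const_mul c s z w

/-- Three points of `ℍ` lie in an open disc contained in `ℍ`. [folklore] -/
theorem exists_ball_subset_upperHalfPlane (z w v : ℍ) :
    ∃ (c : ℂ) (r : ℝ), Metric.ball c r ⊆ {x : ℂ | 0 < x.im} ∧ (z : ℂ) ∈ Metric.ball c r ∧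
      (w : ℂ) ∈ Metric.ball c r ∧ (v : ℂ) ∈ Metric.ball c r := by
  set m : ℝ := min (min z.im w.im) v.im with hm
  have hm0 : 0 < m := lt_min (lt_min z.im_pos w.im_pos) v.im_pos
  set A : ℝ := Complex.normSq z + Complex.normSq w + Complex.normSq v with hA
  have hAz : Complex.normSq z ≤ A := by
    have := Complex.normSq_nonneg (w : ℂ); have := Complex.normSq_nonneg (v : ℂ); linarith
  have hAw : Complex.normSq w ≤ A := by
    have := Complex.normSq_nonneg (z : ℂ); have := Complex.normSq_nonneg (v : ℂ); linarith
  have hAv : Complex.normSq v ≤ A := by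
    have := Complex.normSq_nonneg (z : ℂ); have := Complex.normSq_nonneg (w : ℂ); linarith
  have hA0 : 0 ≤ A := (Complex.normSq_nonneg _).trans hAz
  set R : ℝ := A / m + m with hR
  have hRm : R * m = A + m * m := by
    rw [hR, add_mul, div_mul_cancel₀ _ hm0.ne']
  have hAm : 0 ≤ A / m := div_nonneg hA0 hm0.le
  have hR0 : 0 < R := add_pos_of_nonneg_of_pos hAm hm0
  have hr0 : 0 ≤ R - m / 2 := by rw [hR]; linarith
  refine ⟨(R : ℂ) * Complex.I, R - m / 2, ?_, ?_, ?_, ?_⟩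
  · intro p hp
    rw [Metric.mem_ball, Complex.dist_eq] at hp
    have him : |(p - (R : ℂ) * Complex.I).im| < R - m / 2 :=
      (Complex.abs_im_le_norm _).trans_lt hp
    have h2 : (p - (R : ℂ) * Complex.I).im = p.im - R := by simp
    rw [h2, abs_lt] at him
    show 0 < p.im
    linarith [him.1]
  all_goals
    rw [Metric.mem_ball, Complex.dist_eq]
    refine lt_of_pow_lt_pow_left₀ 2 hr0 ?_
    rw [Complex.sq_norm, Complex.normSq_apply]
    simp only [Complex.sub_re, Complex.mul_re, Complex.ofReal_re, Complex.I_re, mul_zero,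
      Complex.ofReal_im, Complex.I_im, mul_one, sub_self, sub_zero, Complex.sub_im, Complex.mul_im,
      add_zero]
  · have h1 : m ≤ (z : ℂ).im := (min_le_left _ _).trans (min_le_left _ _)
    have h3 : Complex.normSq (z : ℂ) = (z : ℂ).re * (z : ℂ).re + (z : ℂ).im * (z : ℂ).im :=
      Complex.normSq_apply _
    nlinarith [mul_le_mul_of_nonneg_left h1 hR0.le]
  · have h1 : m ≤ (w : ℂ).im := (min_le_left _ _).trans (min_le_right _ _)
    have h3 : Complex.normSq (w : ℂ) = (w : ℂ).re * (w : ℂ).re + (w : ℂ).im * (w : ℂ).im :=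
      Complex.normSq_apply _
    nlinarith [mul_le_mul_of_nonneg_left h1 hR0.le]
  · have h1 : m ≤ (v : ℂ).im := min_le_right _ _
    have h3 : Complex.normSq (v : ℂ) = (v : ℂ).re * (v : ℂ).re + (v : ℂ).im * (v : ℂ).im :=
      Complex.normSq_apply _
    nlinarith [mul_le_mul_of_nonneg_left h1 hR0.le]


/-- **Fundamental theorem of calculus along segments in a disc.** If `s ∘ ofComplex` is
holomorphic on an open disc, it has a primitive `F` there (Mathlib's Morera/primitive theorem
for discs, `DifferentiableOn.isExactOn_ball`), and `∫_a^b s = F(b) − F(a)` for `a, b` in the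
disc. [folklore] -/
theorem exists_segmentIntegral_eq_sub {s : ℍ → ℂ} {c : ℂ} {r : ℝ}
    (hs : DifferentiableOn ℂ (s ∘ ofComplex) (Metric.ball c r)) :
    ∃ F : ℂ → ℂ, ∀ a b : ℍ, (a : ℂ) ∈ Metric.ball c r → (b : ℂ) ∈ Metric.ball c r →
      segmentIntegral s a b = F b - F a := by
  obtain ⟨F, hF⟩ := hs.isExactOn_ball
  refine ⟨F, fun a b ha hb => ?_⟩
  -- the affine path `e(x) = (1 - x) a + x b`, restricted to real `x ∈ [0, 1]`
  have he_deriv : ∀ x : ℂ,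
      HasDerivAt (fun y : ℂ => (1 - y) * (a : ℂ) + y * (b : ℂ)) ((b : ℂ) - a) x := by
    intro x
    have h := (((hasDerivAt_id x).const_sub 1).mul_const (a : ℂ)).add
      ((hasDerivAt_id x).mul_const (b : ℂ))
    exact h.congr_deriv (by ring)
  have hmem : ∀ t ∈ Set.Icc (0 : ℝ) 1,
      (1 - (t : ℂ)) * (a : ℂ) + (t : ℂ) * (b : ℂ) ∈ Metric.ball c r := by
    intro t ht
    have h := (convex_ball c r) ha hb (sub_nonneg.2 ht.2) ht.1 (sub_add_cancel 1 t)
    simpa only [Complex.real_smul, Complex.ofReal_sub, Complex.ofReal_one] using h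
  have hcont_e : Continuous fun t : ℝ => (1 - (t : ℂ)) * (a : ℂ) + (t : ℂ) * (b : ℂ) := by
    fun_prop
  -- the integrand is continuous, hence interval integrable
  have hint : IntervalIntegrable
      (fun t : ℝ => s (ofComplex ((1 - (t : ℂ)) * (a : ℂ) + (t : ℂ) * (b : ℂ))) * ((b : ℂ) - a))
      volume 0 1 := by
    refine (ContinuousOn.mul ?_ continuousOn_const).intervalIntegrable
    rw [Set.uIcc_of_le zero_le_one]
    have h : ContinuousOn
        ((s ∘ ofComplex) ∘ fun t : ℝ => (1 - (t : ℂ)) * (a : ℂ) + (t : ℂ) * (b : ℂ))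
        (Set.Icc (0 : ℝ) 1) :=
      hs.continuousOn.comp hcont_e.continuousOn hmem
    exact h
  -- `F ∘ e` is a primitive of the integrand along the path
  have hderiv : ∀ t ∈ Set.uIcc (0 : ℝ) 1,
      HasDerivAt (fun y : ℝ => F ((1 - (y : ℂ)) * (a : ℂ) + (y : ℂ) * (b : ℂ)))
        (s (ofComplex ((1 - (t : ℂ)) * (a : ℂ) + (t : ℂ) * (b : ℂ))) * ((b : ℂ) - a)) t := by
    intro t ht
    rw [Set.uIcc_of_le zero_le_one] at ht
    have h : HasDerivAt (F ∘ fun y : ℂ => (1 - y) * (a : ℂ) + y * (b : ℂ))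
        (s (ofComplex ((1 - (t : ℂ)) * (a : ℂ) + (t : ℂ) * (b : ℂ))) * ((b : ℂ) - a)) (t : ℂ) :=
      (hF _ (hmem t ht)).comp (t : ℂ) (he_deriv t)
    exact h.comp_ofReal
  have hftc := intervalIntegral.integral_eq_sub_of_hasDerivAt hderiv hint
  simp only [Complex.ofReal_one, sub_self, zero_mul, one_mul, zero_add, Complex.ofReal_zero,
    sub_zero, add_zero] at hftc
  rw [← hftc, segmentIntegral]

/-- **Cauchy's theorem for triangles in `ℍ`, additive form.** For `s` holomorphic on `ℍ`
(`s ∘ ofComplex` complex-differentiable on `{Im > 0}`), segment integrals are additive: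
`∫_z^w s + ∫_w^v s = ∫_z^v s` (the three vertices lie in a disc inside `ℍ`, on which `s` has a
primitive). [folklore] -/
theorem segmentIntegral_add_segmentIntegral {s : ℍ → ℂ}
    (hs : DifferentiableOn ℂ (s ∘ ofComplex) {x : ℂ | 0 < x.im}) (z w v : ℍ) :
    segmentIntegral s z w + segmentIntegral s w v = segmentIntegral s z v := by
  obtain ⟨c, r, hsub, hz, hw, hv⟩ := exists_ball_subset_upperHalfPlane z w v
  obtain ⟨F, hF⟩ := exists_segmentIntegral_eq_sub (hs.mono hsub)
  rw [hF z w hz hw, hF w v hw hv, hF z v hz hv]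
  ring

/-! ### The parametrisation is constant on `Γ`-orbits -/

namespace ShimuraParametrizationData

variable {D M : ℕ} {X : ShimuraCurveData D M} {W : WeierstrassCurve ℚ}
  (P : ShimuraParametrizationData X W)

/-- The pulled-back form of a datum is holomorphic on `ℍ` (as a function of a complex variable;
a private copy of the tree's `differentiableOn_cuspForm_comp_ofComplex`). [folklore] -/
private theorem differentiableOn_form :
    DifferentiableOn ℂ (⇑P.form ∘ ofComplex) {x : ℂ | 0 < x.im} :=
  UpperHalfPlane.mdifferentiable_iff.mp (CuspFormClass.holo P.form)

/-- `∫_{τ₀}^{γτ} form − ∫_{τ₀}^{τ} form = ∫_τ^{γτ} form ∈ Λ_L` for `γ ∈ Γ₀^D(M)` (additivity of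
segment integrals of the holomorphic `form`, and the period condition; a private copy of the
tree's `ShimuraParametrizationData.segmentIntegral_smul_sub_mem` of
`ShimuraCurveDegreeFormulaProofs.lean`, kept local so that this file does not depend on that
sibling). [folklore] -/
private theorem segmentIntegral_smul_sub_mem' {γ : GL (Fin 2) ℝ} (hγ : γ ∈ X.Gamma) (τ : ℍ) :
    segmentIntegral P.form P.basePoint (γ • τ) - segmentIntegral P.form P.basePoint τ ∈
      P.L.lattice := by
  rw [← segmentIntegral_add_segmentIntegral P.differentiableOn_form P.basePoint τ (γ • τ),
    add_sub_cancel_left]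
  exact P.period_mem γ hγ τ

/-- **`φ` is constant on `Γ₀^D(M)`-orbits**: `φ(γτ) = φ(τ)` for `γ ∈ Γ`. [folklore] -/
theorem φ_smul {γ : GL (Fin 2) ℝ} (hγ : γ ∈ X.Gamma) (τ : ℍ) : P.φ (γ • τ) = P.φ τ := by
  rw [← sub_eq_zero, ShimuraParametrizationData.φ, ShimuraParametrizationData.φ, ← map_sub,
    P.uniformize_eq_zero_iff]
  exact P.segmentIntegral_smul_sub_mem' hγ τ

/-- `φ` respects the orbit relation of `Γ₀^D(M)` on `ℍ`. [folklore] -/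
theorem φ_eq_of_orbitRel {a b : ℍ} (h : MulAction.orbitRel X.Gamma ℍ a b) : P.φ a = P.φ b := by
  obtain ⟨γ, rfl⟩ := MulAction.orbitRel_apply.mp h
  exact P.φ_smul γ.2 b

end ShimuraParametrizationData


/-! ### Hecke operators commute with complex scalars -/

/-- `T_n (c • h) = c • T_n h` for `n ≥ 1`: the matrices of `ι(O(n))` have positive determinant
`n`, so Mathlib's slash action is `ℂ`-linear on them (`σ_g = id`). [folklore] -/
theorem ShimuraCurveData.heckeFun_const_smul {D M : ℕ} (X : ShimuraCurveData D M) {n : ℕ}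
    (hn : 0 < n) (c : ℂ) (h : ℍ → ℂ) : X.heckeFun n (c • h) = c • X.heckeFun n h := by
  funext τ
  simp only [ShimuraCurveData.heckeFun, Pi.smul_apply, smul_eq_mul]
  rw [mul_finsum]
  refine finsum_congr fun q => ?_
  have hdet : 0 < ((q.out : X.heckeSet n) : GL (Fin 2) ℝ).det.val := by
    rw [Matrix.GeneralLinearGroup.val_det_apply, (q.out : X.heckeSet n).2.2]
    exact_mod_cast hn
  have hσ : UpperHalfPlane.σ ((q.out : X.heckeSet n) : GL (Fin 2) ℝ) c = c := by
    unfold UpperHalfPlane.σ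
    rw [if_pos hdet]
    rfl
  rw [ModularForm.smul_slash, hσ, Pi.smul_apply, smul_eq_mul]

/-! ### Composing a datum with an analytic isogeny `z ↦ α z : ℂ/Λ → ℂ/Λ'` -/

namespace ShimuraParametrizationData

open Literature.NumberTheory.EllipticCurves.ModularForms

variable {D M : ℕ} {X : ShimuraCurveData D M} {W W' : WeierstrassCurve ℚ}

/-- **The composite datum `[α] ∘ φ`.** Let `P` be a Shimura-curve parametrisation datum of `W`
(lattice `Λ = Λ_L`, map `φ = u ∘ ∫ form`), `W'` an elliptic curve with the same `L`-function
coefficients as `W` (e.g. `ℚ`-isogenous to `W`), `L'` a Néron lattice of `W' ⊗ ℂ` and `α ≠ 0` a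
complex number with `αΛ ⊆ Λ'` (an analytic isogeny `z ↦ αz : ℂ/Λ → ℂ/Λ'`, of degree
`k = #ker = [Λ' : αΛ]`). Then `W'` carries a datum on the same curve `X₀^D(M)` of degree
`k · deg φ`: the form `α · form` (periods in `αΛ ⊆ Λ'`, same Hecke eigenvalues), the
uniformisation `u' : ℂ → W'(ℂ)` of `Λ'` (a theorem of the tree, Silverman AEC VI.3.6(b)), and the
fibre count of the composite `Γ\ℍ → W(ℂ) → W'(ℂ)` (every fibre of the second map has `k`
points; `finite_setOf_natCard_fiber_comp_ne`). This is the construction "compose `q ∘ j` with an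
isogeny `A → E'`" of Pasten §16 p. 49 / proof of Prop. 5.1 p. 17, in the tree's analytic
currency. [cite: PastenShimura2024, §16 p. 49 and proof of Prop. 5.1 p. 17] -/
theorem exists_deg_eq_natCard_ker_mul [W'.IsElliptic] (P : ShimuraParametrizationData X W)
    (hLf : W.LFunction = W'.LFunction) {L' : PeriodPair}
    (hL' : IsNeronLatticeOf (W'.baseChange ℂ) L') {α : ℂ} (hα0 : α ≠ 0)
    (hα : ∀ z ∈ P.L.lattice, α * z ∈ L'.lattice) :
    ∃ P' : ShimuraParametrizationData X W',
      P'.deg = Nat.card (mulQuotientMap P.L.lattice.toAddSubgroup L'.lattice.toAddSubgroup α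
        hα).ker * P.deg := by
  classical
  haveI : (W'.baseChange ℂ).IsElliptic := by
    rw [WeierstrassCurve.baseChange]; infer_instance
  -- the uniformisation of `W'(ℂ)` by `ℂ/Λ'`
  obtain ⟨u', hker', hsurj', hspec'⟩ := IsNeronLatticeOf.exists_uniformize_holds hL'
  -- the kernels of the two uniformisations
  have hkerP : P.L.lattice.toAddSubgroup = P.uniformize.ker := by
    ext z
    simp only [Submodule.mem_toAddSubgroup, AddMonoidHom.mem_ker]
    exact (P.uniformize_eq_zero_iff z).symm
  have hkerQ : L'.lattice.toAddSubgroup = u'.ker := by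
    ext z
    rw [Submodule.mem_toAddSubgroup, ← SetLike.mem_coe, ← hker', SetLike.mem_coe]
  -- `ℂ/Λ ≃ W(ℂ)`, `ℂ/Λ' ≃ W'(ℂ)` and the analytic isogeny `g` on points: `g (u z) = u' (α z)`
  set m := mulQuotientMap P.L.lattice.toAddSubgroup L'.lattice.toAddSubgroup α hα with hm
  set e := QuotientAddGroup.liftEquiv P.L.lattice.toAddSubgroup P.uniformize_surjective hkerP
    with he
  set e' := QuotientAddGroup.liftEquiv L'.lattice.toAddSubgroup hsurj' hkerQ with he'
  set g : (W.baseChange ℂ).toAffine.Point → (W'.baseChange ℂ).toAffine.Point :=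
    fun Pt => e' (m (e.symm Pt)) with hg
  have hg_apply : ∀ z : ℂ, g (P.uniformize z) = u' (α * z) := by
    intro z
    have h1 : e.symm (P.uniformize z) = (z : ℂ ⧸ P.L.lattice.toAddSubgroup) := by
      rw [AddEquiv.symm_apply_eq]
      exact (QuotientAddGroup.liftEquiv_coe _ _ _ z).symm
    simp only [hg, h1, hm, mulQuotientMap_mk, he']
    exact QuotientAddGroup.liftEquiv_coe _ _ _ _
  -- every fibre of `g` has `#ker m` elements, a positive (finite) number
  have hk : ∀ Q, Nat.card {Pt // g Pt = Q} = Nat.card m.ker := by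
    intro Q
    rw [← natCard_fiber_mulQuotientMap (hc := hα) hα0 (e'.symm Q)]
    refine Nat.card_congr (Equiv.subtypeEquiv e.symm.toEquiv fun Pt => ?_)
    simp only [hg, AddEquiv.toEquiv_eq_coe, AddEquiv.coe_toEquiv]
    exact AddEquiv.apply_eq_iff_symm_apply e'
  haveI hkfin : Finite m.ker :=
    finite_ker_mulQuotientMap P.L.basis (by rw [← P.L.lattice_eq_span_range_basis]) L' hα hα0
  have hkpos : 0 < Nat.card m.ker := Nat.card_pos
  -- the map on the orbit space and its exceptional set
  set φq : MulAction.orbitRel.Quotient X.Gamma ℍ → (W.baseChange ℂ).toAffine.Point :=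
    Quotient.lift P.φ fun _ _ h => P.φ_eq_of_orbitRel h with hφq
  set S : Set (W.baseChange ℂ).toAffine.Point :=
    {Pt | Nat.card {y : MulAction.orbitRel.Quotient X.Gamma ℍ // φq y = Pt} ≠ P.deg} with hS_def
  have hE₁ : ∀ Pt : (W.baseChange ℂ).toAffine.Point,
      {y : MulAction.orbitRel.Quotient X.Gamma ℍ // ∃ τ : ℍ,
        (Quotient.mk _ τ : MulAction.orbitRel.Quotient X.Gamma ℍ) = y ∧
          P.uniformize (segmentIntegral P.form P.basePoint τ) = Pt} ≃
      {y : MulAction.orbitRel.Quotient X.Gamma ℍ // φq y = Pt} := fun Pt =>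
    Equiv.subtypeEquivRight fun y =>
      ⟨fun ⟨τ, h1, h2⟩ => h1 ▸ (h2 : φq (Quotient.mk _ τ) = Pt), fun h => by
        obtain ⟨τ, rfl⟩ := Quotient.exists_rep y
        exact ⟨τ, rfl, h⟩⟩
  have hSfin : S.Finite := by
    refine P.deg_spec.subset fun Pt hPt => ?_
    rw [Set.mem_setOf_eq, Nat.card_congr (hE₁ Pt)]
    exact hPt
  have hS : ∀ Pt ∉ S, Nat.card {y : MulAction.orbitRel.Quotient X.Gamma ℍ // φq y = Pt} =
      P.deg := fun Pt hPt => by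
    simpa only [hS_def, Set.mem_setOf_eq, not_not] using hPt
  have hmain := finite_setOf_natCard_fiber_comp_ne φq g hk hkpos hSfin hS P.deg_pos
  -- the composite map in terms of the new form and uniformisation
  have hpt : ∀ τ : ℍ, u' (segmentIntegral (⇑(α • P.form)) P.basePoint τ) = g (P.φ τ) := by
    intro τ
    rw [ShimuraParametrizationData.φ, hg_apply]
    congr 1
    exact segmentIntegral_smul α (⇑P.form) P.basePoint τ
  have hE₂ : ∀ Q : (W'.baseChange ℂ).toAffine.Point,
      {y : MulAction.orbitRel.Quotient X.Gamma ℍ // ∃ τ : ℍ,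
        (Quotient.mk _ τ : MulAction.orbitRel.Quotient X.Gamma ℍ) = y ∧
          u' (segmentIntegral (⇑(α • P.form)) P.basePoint τ) = Q} ≃
      {y : MulAction.orbitRel.Quotient X.Gamma ℍ // g (φq y) = Q} := fun Q =>
    Equiv.subtypeEquivRight fun y =>
      ⟨fun ⟨τ, h1, h2⟩ => h1 ▸ ((hpt τ).symm.trans h2 : g (φq (Quotient.mk _ τ)) = Q),
        fun h => by
          obtain ⟨τ, rfl⟩ := Quotient.exists_rep y
          exact ⟨τ, rfl, (hpt τ).trans h⟩⟩
  refine ⟨{ L := L'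
            isNeronLattice := hL'
            uniformize := u'
            ker_uniformize := hker'
            uniformize_surjective := hsurj'
            uniformize_spec := hspec'
            form := α • P.form
            basePoint := P.basePoint
            period_mem := fun γ hγ z => ?_
            hecke_eq := fun ℓ hℓ hℓDM => ?_
            deg := Nat.card m.ker * P.deg
            deg_pos := Nat.mul_pos hkpos P.deg_pos
            deg_spec := ?_ }, rfl⟩
  · -- periods of `α • form` lie in `αΛ ⊆ Λ'`
    have h : segmentIntegral (⇑(α • P.form)) z (γ • z) = α * segmentIntegral (⇑P.form) z (γ • z) :=
      segmentIntegral_smul α (⇑P.form) z (γ • z)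
    rw [h]
    exact hα _ (P.period_mem γ hγ z)
  · -- Hecke eigenvalues: `a_ℓ(W') = a_ℓ(W)`
    have h : X.heckeFun ℓ (⇑(α • P.form)) = α • X.heckeFun ℓ (⇑P.form) :=
      X.heckeFun_const_smul hℓ.pos α (⇑P.form)
    rw [h, P.hecke_eq ℓ hℓ hℓDM, hLf]
    funext τ
    simp only [Pi.smul_apply, smul_eq_mul, CuspForm.IsGLPos.smul_apply]
    ring
  · -- the fibre count
    refine hmain.subset fun Q hQ => ?_
    rw [Set.mem_setOf_eq, ← Nat.card_congr (hE₂ Q)]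
    exact hQ

end ShimuraParametrizationData


/-! ### The reduction of `minimalDegree_le_163_mul` to the theorem of Mazur–Kenku -/

open Literature.NumberTheory.EllipticCurves Literature.NumberTheory.EllipticCurves.ModularForms
  _root_.WeierstrassCurve in
/-- **The minimal parametrisation degree of an isogenous curve is at most `163 · deg`, from
Mazur–Kenku.** Pasten §16 p. 49: *"Since `A_{1,N}` and `A_{D,M}` are both isogenous to `E`, they
are connected by an isogeny of degree `≤ 163`"*; proof of Lemma 6.8, p. 22: *"Let `α : A → B` be
an isogeny of minimal degree; by results of Mazur [MazurRatIsog] and Kenku [Kenku] we know that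
`n := deg(α) ≤ 163`"*. Granted the tree's named fact `mazurKenku_exists_cyclic_isogeny` (Mazur
1978, Thm. 1; Kenku 1982; Silverman AEC IX.6 Ex. 6.4 — the only input of the printed argument
that is not a theorem of the tree): for ANY datum `P` of `W` on `X₀^D(M)`, any elliptic `W'`
`ℚ`-isogenous to `W`, and `P'` of minimal degree among the data of `W'` on the same curve,
`P'.deg ≤ 163 · P.deg`. Proof: pass to the short models `C • W ⊗ ℂ = E_Λ`, `C' • W' ⊗ ℂ = E_{Λ'}`
(`Λ = Λ_{P.L}`, `Λ'` any Néron lattice of `W'`, `exists_isNeronLatticeOf_holds`), take a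
`ℚ`-isogeny `ψ : C • W → C' • W'` of degree `≤ 163` (Mazur–Kenku), read it analytically as
`z ↦ qz`, `qΛ ⊆ Λ'`, `deg ψ = #ker(z ↦ qz : ℂ/Λ → ℂ/Λ')`
(`degree_eq_natCard_ker_mulQuotientMap_of_baseChange_eq_curve`, AEC VI.4.1(b), III.5), and
compose: `exists_deg_eq_natCard_ker_mul` gives a datum of `W'` of degree `deg ψ · P.deg` (the
Hecke line is unchanged as `L(W, s) = L(W', s)`, `IsIsogenous.LFunction_eq`), whence
`P'.deg ≤ deg ψ · P.deg ≤ 163 · P.deg`. [cite: PastenShimura2024, §16 p. 49 and Lemma 6.8 (proof, p. 22)] [cite: Mazur1978, Thm. 1] [cite: Kenku1982] -/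
theorem ShimuraParametrizationData.deg_le_163_mul_deg_of_isIsogenous
    (hMK : mazurKenku_exists_cyclic_isogeny) {D M : ℕ} {X : ShimuraCurveData D M}
    {W W' : WeierstrassCurve ℚ} [W.IsElliptic] [W'.IsElliptic]
    (P : ShimuraParametrizationData X W) (P' : ShimuraParametrizationData X W')
    (hWW' : W'.IsIsogenous W) (hP' : ∀ P'' : ShimuraParametrizationData X W', P'.deg ≤ P''.deg) :
    P'.deg ≤ 163 * P.deg := by
  have hiso : IsIsogenous W W' := hWW'.symm_of_charZero
  haveI : (W'.baseChange ℂ).IsElliptic := by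
    rw [WeierstrassCurve.baseChange]; infer_instance
  -- a Néron lattice of `W'`
  obtain ⟨L', hL'⟩ := exists_isNeronLatticeOf_holds (W'.baseChange ℂ)
  -- the short models are `E_Λ`, `E_{Λ'}` after base change, and are `ℚ`-isogenous
  set C : VariableChange ℚ := ⟨1, -W.b₂ / 12, -W.a₁ / 2, W.a₁ * W.b₂ / 24 - W.a₃ / 2⟩ with hC
  set C' : VariableChange ℚ := ⟨1, -W'.b₂ / 12, -W'.a₁ / 2, W'.a₁ * W'.b₂ / 24 - W'.a₃ / 2⟩
    with hC'
  have hE : (C • W).baseChange ℂ = P.L.curve := shortModel_baseChange_eq_curve W P.isNeronLattice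
  have hE' : (C' • W').baseChange ℂ = L'.curve := shortModel_baseChange_eq_curve W' hL'
  have h : IsIsogenous (C • W) (C' • W') :=
    (isIsogenous_of_smul W C).trans' (hiso.trans' (isIsogenous_smul W' C'))
  -- Mazur–Kenku: a cyclic `ℚ`-isogeny `ψ` of degree `≤ 163`
  obtain ⟨ψ, -, hdeg⟩ := hMK (C • W) (C' • W') h
  have h163 : ψ.degree ≤ 163 := le_of_mem_kenkuDegrees hdeg
  -- its rational multiplier `q`: `qΛ ⊆ Λ'`, `#ker(z ↦ qz) = deg ψ`
  obtain ⟨q, hq0, hq, hdegq⟩ :=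
    degree_eq_natCard_ker_mulQuotientMap_of_baseChange_eq_curve ψ hE hE'
  -- the composite datum of `W'`, of degree `deg ψ · P.deg`
  have hq0' : (q : ℂ) ≠ 0 := by exact_mod_cast hq0
  obtain ⟨P₁, hP₁⟩ := P.exists_deg_eq_natCard_ker_mul hiso.LFunction_eq hL' hq0' hq
  calc P'.deg ≤ P₁.deg := hP' P₁
    _ = ψ.degree * P.deg := by rw [hP₁, hdegq]
    _ ≤ 163 * P.deg := Nat.mul_le_mul_right _ h163

open Literature.NumberTheory.EllipticCurves in
/-- **`minimalDegree_le_163_mul` from Mazur–Kenku, in the exact shape of the named fact.** The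
type of this theorem is, binder for binder, the body of the named fact
`ShimuraParametrizationData.minimalDegree_le_163_mul` of `ShimuraCurveRibetTakahashi.lean`
(Pasten §16 p. 49 with Lemma 6.8, proof, p. 22: if `P` realises `δ_{D,M}(W')` and `P'` has minimal
degree among the data of `W'`, then `P'.deg ≤ 163 · P.deg`), preceded by the hypothesis
`hMK : mazurKenku_exists_cyclic_isogeny`; it is `deg_le_163_mul_deg_of_isIsogenous` with the
isogeny clause of `P.IsMinimalFor W'` (the minimality clause is not needed). Uses: the discharge
`theorem minimalDegree_le_163_mul_holds : minimalDegree_le_163_mul := fun P P' ↦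
minimalDegree_le_163_mul_of_mazurKenku mazurKenku_exists_cyclic_isogeny_holds P P'` once
Mazur–Kenku (Mazur 1978, Thm. 1; Kenku 1982) is a theorem of the tree; and, for a consumer holding
`hMK` instead of the fact, the term `minimalDegree_le_163_mul_of_mazurKenku hMK P₀ P' hP₀ hP'` in
place of `h163 P₀ P' hP₀ hP'`. [cite: PastenShimura2024, §16 p. 49 and Lemma 6.8 (proof, p. 22)] [cite: Mazur1978, Thm. 1] [cite: Kenku1982] -/
theorem ShimuraParametrizationData.minimalDegree_le_163_mul_of_mazurKenku
    (hMK : mazurKenku_exists_cyclic_isogeny) {D M : ℕ} {X : ShimuraCurveData D M}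
    {W W' : WeierstrassCurve ℚ} [W.IsElliptic] [W'.IsElliptic]
    (P : ShimuraParametrizationData X W) (P' : ShimuraParametrizationData X W')
    (hmin : P.IsMinimalFor W') (hP' : ∀ P'' : ShimuraParametrizationData X W', P'.deg ≤ P''.deg) :
    P'.deg ≤ 163 * P.deg :=
  ShimuraParametrizationData.deg_le_163_mul_deg_of_isIsogenous hMK P P' hmin.1 hP'

end Literature.NumberTheory.Automorphic

end
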